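import Summits.Schanuel.Schanuel.Theorems.RootDecomp1KSiegelFunctions08

/-!
# RootDecomp1KSiegelFunctions — lens 1, generation 71, NODE 31 «THE HEIGHT BINDER HALVED: `HeightComparison ⟸ SiegelFunctionsAll`, ARITHMETIC HALF PROVED» (×0-AS-RECORD + one contingent ×1 at FLOOR G (a) — PRICE 31 L3149, RULING L3160, NODE L3172, VERDICT L3175): the node-12 hypothesis binder `HeightComparison` (Weil–Siegel height comparison on a plane curve) is, definitionally, `∀ P, GeomIrreducible P → 1 ≤ xdeg P → 1 ≤ deg_Y P → HeightComparisonAt P`, and `heightComparisonAt_of_siegelFunctions` PROVES `HeightComparisonAt P` from the GEOMETRIC datum `SiegelFunctions P ∧ SiegelFunctions (swap P)` (two integral functions of controlled degree for every b ≥ 1); the ARITHMETIC half (rational-root integrality, archimedean root bound, `h(y^b) = b·h(y)`, finite exceptional fibres by Bezout, exchange of variables) is proved sorry-free; hence `heightComparison_of_siegelFunctionsAll : SiegelFunctionsAll → HeightComparison` and the node-12 heads re-pointed BY NAME; the geometric half `SiegelFunctionsAll` is a typed HYPOTHESIS (plan S1–S6 in the docstring of `SiegelFunctions`), NOT proved;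 (G)-instances by hand: `parabP` / its transpose / `hyperbP`, and the infinite family 𝒞₃ = {(x·Y − 1)² − f(x) : f cubic, f(0) ≠ 1} in BOTH charts (Lucas trace; the 3 × 3 POWER LEMMA), its geometric irreducibility, and the HYPOTHESIS-FREE `heightComparisonAt_sqLinP` / `thinFibreAt_two_sqLinP` — ×0-AS-RECORD toolkit per RULING L3160 (every 𝒞₃ member is also decided by the numerator lever); `PadicSubspace`, items 33364 / 33363 / 31077 / 31987 and the tally UNMOVED — continuation (RootDecomp1KSiegelFunctions09): §11  GEOMETRIC IRREDUCIBILITY OF `𝒞₃` — PROVED; the hypothesis-free heads.  `x²Y² − 2xY + 1 − g(x)` is · §12  THE HYPOTHESIS-FREE HEADS ON `𝒞₃`: the height comparison, and the thin-fibre clause at every — 17 declarations `sqLinK` … `thinFibreAt_of_inC3`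

(lens-1 g71 NODE 31 «THE HEIGHT BINDER HALVED» L3172: HOME kernel K = HOME/decomp-schanuel-lens-1/g71/lean/SiegelFunctions.lean sha256 4f39c136…, 1983 l, 207 decls (173 theorems + 34 defs by the critic's count, VERDICT L3175; NODE's «208» an e-lite), ONE namespace `Summit.Schanuel.Schanuel.Theorems.RootDecomp1KSiegelFunctions` (inner anonymous-free sections `PowerLemma` / `Chart2` / `GeomIrreducible` with their `variable`s kept whole inside one part each), imports EXACTLY the tree port …RootDecomp1KHeightGrading02 (node 12: `HeightComparison`, `HeightDecidedAt`, `GeomIrreducible`, `logHt` BY TREE NAME) + `Literature.NumberTheory.DiophantineGeometry.PlaneCurveBezoutWeak` + `Mathlib.RingTheory.Polynomial.RationalRoot`; no private / instance / set_option / notation / sorry / new axiom / native_decide / [cite; lens farm rc 0 · 0 errors · 0 sorries · dupNamespace warnings only; `#print axioms` = [propext, Classical.choice, Quot.sound] on the nine probed heads (g71/out/ax_*.json), Probe g71/out/ProbeK.lean 2659bdec… rc 0 (rfl pin `HeightComparison` = tree), CONTROLS A / A0 / B rc 1 as designed (ctrlA 4ae3a6d6… / ctrlA0 ff875685… / ctrlB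 f20add70…), memo g71/NODE-g71.md 07fb49f8…, SHA256SUMS 34 files; CLAIM 31 L3146; crit PRICE 31 L3149 (×0-as-record + one contingent ×1 at FLOOR G; CHECKLIST K-g71; RULES K-R59 / K-R60 pre-announced); lens ASK-FIRST FAMILY CLAIM L3158 (𝒞₃) and crit RULING L3160 (𝒞₃ REFUSED as a FLOOR-G (b) family: numerator lever, NUMEXP; toolkit ×0 under K-R60 (i)); census INSTRUMENT NOTES 54–56 L3161 / L3163 / L3167 (LIVENESS-v46 / v47 / v48: rows 75–77 = 𝒞₃ members, keys numexp / numexp_tight / k60) and crit ACKs L3165 / L3168; writer NOTES 4 / 5 L3162 / L3173; crit-1 (g13) VERDICT 31 L3175: «NODE 31 = ×0-AS-RECORD BOOKED; CHECKLIST K-g71 (J1)–(J7) MET; the contingent THEOREM ×1 REGISTERED under K-R59 (ii), UNPAID (FLOOR G unmet); RULES K-R59 and K-R60 (i)–(iv) FIXED; PORT GO» — kernel re-verified by the critic (farm rc 0 · 0 errors · 0 sorries; 207 decls = 173 theorems + 34 defs; axioms standard re-probed on 27 heads), record: piece C227 «HeightComparison ⟸ SiegelFunctionsAll», the K-line binder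 HeightComparison henceforth CONSUMED through heightComparison_of_siegelFunctionsAll (Dom re-pointing BY NAME, antecedent count unchanged), 𝒞₃ / InC3 decided hypothesis-free by thinFibreAt_of_inC3 / thinFibreAt_two_sqLinP = the K-R60 (i) kernel shape (TOOLKIT, ×0, never payable), tally UNCHANGED lens-1 ×22 + THEOREM ×24, EXHIBITS ρ1 / ρ2 VACANT, 33364 / 33363 / 31077 / 31987 OPEN rung 0. Port by census-1 gen 26 as `RootDecomp1KSiegelFunctions01–09` (files ≤ 400 lines; chain 01 ← the three K imports, 0k ← 0(k−1); `--supports stmt-Schanuel-33364`, the item stays OPEN; ×0 record port — the geometric binder `SiegelFunctions` / `SiegelFunctionsAll` appears ONLY as an explicit hypothesis of the `…_of_siegelFunctions…` heads, never an axiom / instance / variable; no credit anywhere; the section-aligned 9-part split is lens-1's port plan (J7) re-built by the census pipeline): 01 = K-port l.1–216 (§0 / §1) — 25 decls `ratModel`, `QDvd`, `relPoly`, …, `evalEval_ratModel_relPoly`; 02 = K-port l.219–450 (§2) — 20 decls `scaledEval`, `l1`, `l1_nonneg`, …, `abs_le_of_rel`; 03 = K-port l.453–658 (§3 / §4) — 9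 decls `HtQ_pow`, `logHt_pow`, `HtQ_intDiv_le`, …, `upperComparisonAt_of_siegelFunctions`; 04 = K-port l.661–830 (§5) — 13 decls `coeff_coeff_swap`, `map_swap`, `natDegree_swap`, …, `heightComparison_of_siegelFunctions`; 05 = K-port l.833–1109 (§6 / §7) — 28 decls `thinFibreAt_of_heightComparisonAt`, `thinFibreAt_of_heightComparison'`, `thinFibreAt_of_siegelFunctions`, …, `siegelFunctions_toys`; 06 = K-port l.1111–1304 (§8) — 20 decls `sqLinP`, `sqLinP_eq`, `natDegree_sqLinP`, …, `thinFibreAt_sqLinP_of_swap`; 07 = K-port l.1306–1551 (§9) — 35 decls `compM`, `cubic`, `cubic_eq`, …, `natDegree_det3_compM_pow_le`; 08 = K-port l.1553–1860 (§10) — 40 decls `q₃`, `q₂`, `q₁`, …, `heightComparisonAt_sqLinP_of_geomIrreducible`; 09 = K-port l.1862–2078 (§11 / §12) — 17 decls `sqLinK`, `coeff_sqLinK`, `natDegree_sqLinK`, …, `thinFibreAt_of_inC3`. 91 one-line docstrings synthesised for undocumented helper declarations (statements quoted); TWO port-side modifiers of record: `sum_Icc_half_pow` (§2, part 02) is `private`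 with a PORT NOTE after the `dedup.landed` bounce p850627 (≡ `Literature.Computability.Cryptography.HashDom.sum_Icc_half_pow`), and the consistency check `thinFibreAt_of_heightComparison'` (§6, part 05) is `private` with a PORT NOTE after the `dedup.landed` bounce p850703 (≡ node 12's `RootDecomp1KHeightGrading.thinFibreAt_of_heightComparison`, the intended identity); everything else = K VERBATIM (statements, names, proofs, K's module docstring kept in part 01 below this provenance block).)
-/

noncomputable section

namespace Summit.Schanuel.Schanuel.Theorems.RootDecomp1KSiegelFunctions

open Polynomial
open scoped Nat
open Summit.Schanuel.Schanuel.Theorems.RootDecomp1KDegreeLadder (bev xdeg natDegree_coeff_le_xdeg ThinFibreAt ThinFibre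
  thinFibreAt_of_natDegree_lt)
open Summit.Schanuel.Schanuel.Theorems.RootDecomp1KHeightGrading

/-! ### §11  GEOMETRIC IRREDUCIBILITY OF `𝒞₃` — PROVED; the hypothesis-free heads.  `x²Y² − 2xY + 1 − g(x)` is
irreducible in `K[x][Y]` for EVERY field `K` and every cubic `g` with `g(0) ≠ 1` (a constant factor divides `x²` and
`1 − g`, so is a unit; a factorisation into two `Y`-linear factors `(αY + β)(γY + δ)` has `αγ = x²`, and each of the
three splittings of `x²` is refuted: a unit `α` or `γ` forces `x ∣ 1 − g`, and `α ~ γ ~ x` forces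
`deg (a'δ + c'β) ≥ 2` against `a'δ + c'β = −2`).  Applied with `K = ℚ̄`: `GeomIrreducible (sqLinP f)`. -/

section GeomIrreducible

variable {K : Type*} [Field K]

/-- the shape `x²Y² − 2xY + (1 − g(x))` over a field. -/
noncomputable def sqLinK (g : K[X]) : K[X][X] := C (X ^ 2) * X ^ 2 - C (2 * X) * X + C (1 - g)

/-- `(g : K[X]) (n : ℕ) : (sqLinK g).coeff n = if n = 2 then X ^ 2 else if n = 1 then -(2 * X) else if n = 0 then 1 - g else 0`. -/
theorem coeff_sqLinK (g : K[X]) (n : ℕ) :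
    (sqLinK g).coeff n = if n = 2 then X ^ 2 else if n = 1 then -(2 * X) else if n = 0 then 1 - g else 0 := by
  simp only [sqLinK, coeff_add, coeff_sub, coeff_C_mul, coeff_X_pow, coeff_X, coeff_C]
  rcases Nat.lt_or_ge n 3 with h | h
  · interval_cases n <;> simp
  · simp [show n ≠ 0 by omega, show n ≠ 2 by omega, show n ≠ 1 by omega, show (1 : ℕ) ≠ n by omega]

/-- `(g : K[X]) : (sqLinK g).natDegree = 2`. -/
theorem natDegree_sqLinK (g : K[X]) : (sqLinK g).natDegree = 2 := by
  apply le_antisymm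
  · rw [natDegree_le_iff_coeff_eq_zero]
    intro n hn
    rw [coeff_sqLinK]
    have hn' : 2 < n := by exact_mod_cast hn
    simp [show n ≠ 0 by omega, show n ≠ 2 by omega, show n ≠ 1 by omega]
  · refine le_natDegree_of_ne_zero ?_
    rw [coeff_sqLinK]; simp

/-- `{q : K[X]} (h : q ∣ X ^ 2) : IsUnit q ∨ X ∣ q`. -/
theorem dvd_X_sq {q : K[X]} (h : q ∣ X ^ 2) : IsUnit q ∨ X ∣ q := by
  obtain ⟨i, hi, hq⟩ := (dvd_prime_pow prime_X 2).mp h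
  rcases Nat.eq_zero_or_pos i with rfl | hi0
  · left; rw [pow_zero] at hq; exact associated_one_iff_isUnit.mp hq
  · right; exact hq.dvd_iff_dvd_right.mpr (dvd_pow_self X hi0.ne')

/-- `{g : K[X]} (h0 : g.coeff 0 ≠ 1) : ¬ X ∣ (1 - g)`. -/
theorem not_X_dvd_one_sub {g : K[X]} (h0 : g.coeff 0 ≠ 1) : ¬ X ∣ (1 - g) := by
  rw [X_dvd_iff, coeff_sub, coeff_one_zero, sub_eq_zero]
  exact fun h => h0 h.symm

/-- `(α β γ δ : K[X]) : (C α * X + C β) * (C γ * X + C δ) = C (α * γ) * X ^ 2 + C (α * δ + β * γ) * X + C (β * δ)`. -/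
theorem mul_lin_eq (α β γ δ : K[X]) : (C α * X + C β) * (C γ * X + C δ) =
    C (α * γ) * X ^ 2 + C (α * δ + β * γ) * X + C (β * δ) := by
  simp only [map_mul, map_add]; ring

/-- `(a b c : K[X]) (n : ℕ) : (C a * X ^ 2 + C b * X + C c : K[X][X]).coeff n = if n = 2 then a else if n = 1 then b else if n = 0 then c else 0`. -/
theorem coeff_lin2 (a b c : K[X]) (n : ℕ) : (C a * X ^ 2 + C b * X + C c : K[X][X]).coeff n =
    if n = 2 then a else if n = 1 then b else if n = 0 then c else 0 := by
  simp only [coeff_add, coeff_C_mul, coeff_X_pow, coeff_X, coeff_C]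
  rcases Nat.lt_or_ge n 3 with h | h
  · interval_cases n <;> simp
  · simp [show n ≠ 0 by omega, show n ≠ 2 by omega, show n ≠ 1 by omega, show (1 : ℕ) ≠ n by omega]

/-- **`x²Y² − 2xY + 1 − g(x)` is irreducible over `K[x]` for every cubic `g` with `g(0) ≠ 1`** (any field `K`). -/
theorem irreducible_sqLinK {g : K[X]} (hg : g.natDegree = 3) (h0 : g.coeff 0 ≠ 1) : Irreducible (sqLinK g) := by
  have hP2 := natDegree_sqLinK g
  have hP0 : sqLinK g ≠ 0 := by intro h; rw [h, natDegree_zero] at hP2; exact absurd hP2 (by norm_num)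
  have h1g : (1 - g).natDegree = 3 := by
    rw [natDegree_sub_eq_right_of_natDegree_lt (by rw [natDegree_one]; omega), hg]
  have h1g0 : (1 - g) ≠ 0 := by intro h; rw [h, natDegree_zero] at h1g; exact absurd h1g (by norm_num)
  -- a constant factor is a unit
  have hconst : ∀ a : K[X], C a ∣ sqLinK g → IsUnit a := by
    intro a ha
    rw [C_dvd_iff_dvd_coeff] at ha
    have h2 := ha 2; have h0' := ha 0
    rw [coeff_sqLinK] at h2 h0'; simp only [if_true] at h2
    simp only [show (0:ℕ) ≠ 2 from by decide, show (0:ℕ) ≠ 1 from by decide, if_false, if_true] at h0'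
    rcases dvd_X_sq h2 with hu | hX
    · exact hu
    · exact absurd (dvd_trans hX h0') (not_X_dvd_one_sub h0)
  refine ⟨fun hu => ?_, fun A B hAB => ?_⟩
  · have := natDegree_eq_zero_of_isUnit hu; omega
  · have hA : A ≠ 0 := by rintro rfl; rw [zero_mul] at hAB; exact hP0 hAB
    have hB : B ≠ 0 := by rintro rfl; rw [mul_zero] at hAB; exact hP0 hAB
    have hdeg : A.natDegree + B.natDegree = 2 := by rw [← natDegree_mul hA hB, ← hAB, hP2]
    by_cases hA0 : A.natDegree = 0
    · left
      rw [eq_C_of_natDegree_eq_zero hA0] at hAB ⊢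
      exact isUnit_C.mpr (hconst _ ⟨B, hAB⟩)
    by_cases hB0 : B.natDegree = 0
    · right
      rw [eq_C_of_natDegree_eq_zero hB0] at hAB ⊢
      exact isUnit_C.mpr (hconst _ ⟨A, by rw [hAB, mul_comm]⟩)
    exfalso
    have hA1 : A.natDegree = 1 := by omega
    have hB1 : B.natDegree = 1 := by omega
    set α := A.coeff 1; set β := A.coeff 0; set γ := B.coeff 1; set δ := B.coeff 0
    have hA' : A = C α * X + C β := eq_X_add_C_of_natDegree_le_one hA1.le
    have hB' : B = C γ * X + C δ := eq_X_add_C_of_natDegree_le_one hB1.le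
    rw [hA', hB', mul_lin_eq] at hAB
    have e2 : X ^ 2 = α * γ := by
      have := congrArg (fun p => Polynomial.coeff p 2) hAB; simp only [coeff_sqLinK, coeff_lin2] at this; simpa using this
    have e1 : -(2 * X) = α * δ + β * γ := by
      have := congrArg (fun p => Polynomial.coeff p 1) hAB; simp only [coeff_sqLinK, coeff_lin2] at this; simpa using this
    have e0 : 1 - g = β * δ := by
      have := congrArg (fun p => Polynomial.coeff p 0) hAB; simp only [coeff_sqLinK, coeff_lin2] at this; simpa using this
    have hβ : β ≠ 0 := by intro h; rw [h, zero_mul] at e0; exact h1g0 e0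
    have hδ : δ ≠ 0 := by intro h; rw [h, mul_zero] at e0; exact h1g0 e0
    have hX1g : ¬ X ∣ β * δ := by rw [← e0]; exact not_X_dvd_one_sub h0
    rcases dvd_X_sq (⟨γ, e2⟩ : α ∣ X ^ 2) with hαu | hXα
    · -- α unit ⇒ X ∣ γ ⇒ X ∣ α δ ⇒ X ∣ δ
      have hXγ : X ∣ γ := by
        have : X ∣ α * γ := ⟨X, by rw [← e2, pow_two]⟩
        exact (hαu.dvd_mul_left).mp this
      have hXδ : X ∣ δ := by
        have : X ∣ α * δ := by
          have h := dvd_sub (⟨-2, by ring⟩ : (X : K[X]) ∣ -(2 * X)) (dvd_mul_of_dvd_right hXγ β)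
          rwa [e1, add_sub_cancel_right] at h
        exact (hαu.dvd_mul_left).mp this
      exact hX1g (dvd_mul_of_dvd_right hXδ β)
    · rcases dvd_X_sq (⟨α, by rw [e2, mul_comm]⟩ : γ ∣ X ^ 2) with hγu | hXγ
      · -- γ unit ⇒ X ∣ α (have it) ⇒ X ∣ β γ ⇒ X ∣ β
        have hXβ : X ∣ β := by
          have : X ∣ β * γ := by
            have h := dvd_sub (⟨-2, by ring⟩ : (X : K[X]) ∣ -(2 * X)) (dvd_mul_of_dvd_left hXα δ)
            rwa [e1, add_sub_cancel_left] at h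
          exact (hγu.dvd_mul_right).mp this
        exact hX1g (dvd_mul_of_dvd_left hXβ δ)
      · -- X ∣ α and X ∣ γ: α = X a', γ = X c' with a' c' = 1; then a' δ + β c' = -2 has degree ≥ 2: contradiction
        obtain ⟨a', ha'⟩ := hXα
        obtain ⟨c', hc'⟩ := hXγ
        have hac : a' * c' = 1 := by
          have h := e2; rw [ha', hc', pow_two] at h
          have : X * (X * (a' * c')) = X * (X * 1) := by rw [mul_one]; linear_combination -h
          exact mul_left_cancel₀ X_ne_zero (mul_left_cancel₀ X_ne_zero this)
        have ha'0 : a' ≠ 0 := left_ne_zero_of_mul_eq_one hac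
        have hc'0 : c' ≠ 0 := right_ne_zero_of_mul_eq_one hac
        have hda : a'.natDegree = 0 := by
          have := natDegree_mul ha'0 hc'0; rw [hac, natDegree_one] at this; omega
        have hdc : c'.natDegree = 0 := by
          have := natDegree_mul ha'0 hc'0; rw [hac, natDegree_one] at this; omega
        have elin : a' * δ + β * c' = -2 := by
          have h := e1; rw [ha', hc'] at h
          have : X * (a' * δ + β * c') = X * (-2) := by linear_combination -h
          exact mul_left_cancel₀ X_ne_zero this
        have hsum : β.natDegree + δ.natDegree = 3 := by rw [← natDegree_mul hβ hδ, ← e0, h1g]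
        have hdeg2 : (a' * δ + β * c').natDegree = 0 := by
          rw [elin]; exact natDegree_neg (2 : K[X]) ▸ natDegree_ofNat 2 |>.trans rfl |> fun h => by
            rw [natDegree_neg]; simp
        have hdaδ : (a' * δ).natDegree = δ.natDegree := by
          rw [eq_C_of_natDegree_eq_zero hda, natDegree_C_mul]
          intro h; apply ha'0; rw [eq_C_of_natDegree_eq_zero hda, h, map_zero]
        have hdβc : (β * c').natDegree = β.natDegree := by
          rw [eq_C_of_natDegree_eq_zero hdc, natDegree_mul_C]
          intro h; apply hc'0; rw [eq_C_of_natDegree_eq_zero hdc, h, map_zero]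
        rcases Nat.lt_or_ge β.natDegree δ.natDegree with hlt | hge
        · have : (a' * δ + β * c').natDegree = δ.natDegree := by
            rw [natDegree_add_eq_left_of_natDegree_lt (by rw [hdaδ, hdβc]; exact hlt), hdaδ]
          omega
        · have hlt : δ.natDegree < β.natDegree := by omega
          have : (a' * δ + β * c').natDegree = β.natDegree := by
            rw [natDegree_add_eq_right_of_natDegree_lt (by rw [hdaδ, hdβc]; exact hlt), hdβc]
          omega

/-- `(f : ℤ[X]) {K : Type*} [Field K] (hom : ℤ →+* K) : (sqLinP f).map (mapRingHom hom) = sqLinK (f.map hom)`. -/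
theorem map_sqLinP_eq (f : ℤ[X]) {K : Type*} [Field K] (hom : ℤ →+* K) :
    (sqLinP f).map (mapRingHom hom) = sqLinK (f.map hom) := by
  rw [sqLinP_eq, sqLinK]
  simp only [Polynomial.map_add, Polynomial.map_sub, Polynomial.map_mul, Polynomial.map_pow, Polynomial.map_C,
    Polynomial.map_X, coe_mapRingHom, Polynomial.map_one, Polynomial.map_ofNat]

/-- **`GeomIrreducible ((xY − 1)² − f(x))` for every cubic `f ∈ ℤ[x]` with `f(0) ≠ 1` — PROVED.** -/
theorem geomIrreducible_sqLinP {f : ℤ[X]} (hf : f.natDegree = 3) (h0 : f.coeff 0 ≠ 1) :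
    GeomIrreducible (sqLinP f) := by
  unfold GeomIrreducible
  rw [map_sqLinP_eq]
  refine irreducible_sqLinK ?_ ?_
  · rw [natDegree_map_eq_of_injective (RingHom.injective_int _), hf]
  · rw [coeff_map, eq_intCast]; exact_mod_cast h0

end GeomIrreducible

/-! ### §12  THE HYPOTHESIS-FREE HEADS ON `𝒞₃`: the height comparison, and the thin-fibre clause at every
`m₀ ≥ 2`, for EVERY cubic `f ∈ ℤ[x]` with `f(0) ≠ 1` — no hypothesis binder at all (both Siegel-function charts §8/§10,
geometric irreducibility §11, THEOREM A of node 12).  By RULING L3160 these curves are ALSO decided by the elementary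
«numerator lever» (so this is a ×0 toolkit theorem, K-R60 (i)); here they are decided by the height machine. -/

/-- the family `𝒞₃` as a typed predicate on `ℤ[x][Y]`. -/
def InC3 (P : ℤ[X][X]) : Prop := ∃ f : ℤ[X], f.natDegree = 3 ∧ f.coeff 0 ≠ 1 ∧ P = sqLinP f

/-- **BOTH SIEGEL-FUNCTION CHARTS ON `𝒞₃`, hypothesis-free.** -/
theorem siegelFunctions_both_of_inC3 {P : ℤ[X][X]} (h : InC3 P) :
    SiegelFunctions P ∧ SiegelFunctions (Bivariate.swap P) := by
  obtain ⟨f, hf, h0, rfl⟩ := h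
  exact ⟨siegelFunctions_sqLinP f (by omega), sqLinSwapSiegel f hf h0⟩

/-- **`𝒞₃` lies in node 12's class**: geometrically irreducible, `xdeg = 3 ≥ 1`, `deg_Y = 2 < 2·xdeg`. -/
theorem inC3_class {P : ℤ[X][X]} (h : InC3 P) : GeomIrreducible P ∧ xdeg P = 3 ∧ P.natDegree = 2 := by
  obtain ⟨f, hf, h0, rfl⟩ := h
  exact ⟨geomIrreducible_sqLinP hf h0, by rw [xdeg_sqLinP (by omega), hf], natDegree_sqLinP f⟩

/-- **THE HEIGHT COMPARISON ON EVERY CURVE OF `𝒞₃` — UNCONDITIONAL** (`|3·h(x) − 2·h(y)| ≤ ε·h(x) + c` at the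
rational points of `(xY − 1)² = f(x)`, `f` cubic, `f(0) ≠ 1`). -/
theorem heightComparisonAt_sqLinP {f : ℤ[X]} (hf : f.natDegree = 3) (h0 : f.coeff 0 ≠ 1) :
    HeightComparisonAt (sqLinP f) :=
  heightComparisonAt_sqLinP_of_geomIrreducible hf h0 (geomIrreducible_sqLinP hf h0)

/-- **`ThinFibreAt 2 ((xY − 1)² − f(x))` for EVERY cubic `f` with `f(0) ≠ 1` — UNCONDITIONAL** (the K-R60 (i) shape,
here via the height machine). -/
theorem thinFibreAt_two_sqLinP {f : ℤ[X]} (hf : f.natDegree = 3) (h0 : f.coeff 0 ≠ 1) : ThinFibreAt 2 (sqLinP f) :=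
  thinFibreAt_two_sqLinP_of_geomIrreducible hf h0 (geomIrreducible_sqLinP hf h0)

/-- … and at every `m₀ ≥ 2`. -/
theorem thinFibreAt_sqLinP {f : ℤ[X]} (hf : f.natDegree = 3) (h0 : f.coeff 0 ≠ 1) {m₀ : ℕ} (hm : 2 ≤ m₀) :
    ThinFibreAt m₀ (sqLinP f) :=
  thinFibreAt_sqLinP_of_geomIrreducible hf h0 (geomIrreducible_sqLinP hf h0) hm

/-- the same on the typed family. -/
theorem thinFibreAt_of_inC3 {P : ℤ[X][X]} (h : InC3 P) {m₀ : ℕ} (hm : 2 ≤ m₀) : ThinFibreAt m₀ P := by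
  obtain ⟨f, hf, h0, rfl⟩ := h
  exact thinFibreAt_sqLinP hf h0 hm

end Summit.Schanuel.Schanuel.Theorems.RootDecomp1KSiegelFunctions
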